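import Literature.NumberTheory.ModularForms.LevelOneHeckeSturmGenerators
import HarnessLib

/-!
# Deligne–Serre lifting for `S_k(SL₂(ℤ))`: a character of `𝕋_ℤ` modulo a prime is the reduction of the eigenvalue
# character of a normalized eigenform

P. Deligne, J.-P. Serre, *Formes modulaires de poids 1*, Ann. Sci. ÉNS (4) **7** (1974), **Lemme 6.11** (p. 522),
verbatim: «Soit `M` un module libre de type fini sur un anneau de valuation discrète `𝒪` ; on note `𝔪` l'idéal maximal
de `𝒪`, `k` son corps résiduel, `K` son corps des fractions. Soit `𝒯` un ensemble d'endomorphismes de `M` commutant deux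
à deux. Soit `f ∈ M/𝔪M` un vecteur propre commun (non nul) des `T ∈ 𝒯`, et soient `a_T ∈ k` les valeurs propres
correspondantes. Il existe alors un anneau de valuation discrète `𝒪'` contenant `𝒪` … et un élément non nul `f'` de
`M' = 𝒪' ⊗_𝒪 M`, qui est vecteur propre des `T ∈ 𝒯`, de valeurs propres `a'_T` telles que `a'_T ≡ a_T (mod 𝔪')`.»
and its proof: «Soit `ℋ` la sous-algèbre de `End(M)` engendrée par `𝒯`. Quitte à faire une extension finie des
scalaires, on peut supposer que `K ⊗ ℋ` est un produit d'anneaux artiniens de corps résiduel `K`. Soit `χ : ℋ → k`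
l'homomorphisme tel que `h.f = χ(h) f` pour tout `h ∈ ℋ`. Puisque `ℋ` est libre sur `𝒪`, il existe un idéal premier
`𝔭` de `ℋ` contenu dans l'idéal maximal `Ker(χ)` et tel que `𝔭 ∩ 𝒪 = 0` ; c'est le noyau d'un homomorphisme
`χ' : ℋ → 𝒪` dont la réduction mod `𝔪` est `χ`.»

B. Datskovsky, P. Guerzhoy, Proc. AMS **124** (1996) p. 2285–2286, Theorem 2 and its proof ("This theorem follows
easily from Theorem 1 and Lemma 6.11 of [Deligne–Serre]") apply exactly this to `ℋ = 𝕋_ℤ(S_k(SL₂(ℤ)))` after the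
«extension des scalaires» to a number field `K` containing the Fourier coefficients of all normalized eigenforms —
the SPLIT case, where `K ⊗ ℋ ≅ K^{dim S_k}` is diagonalised by the eigenvalue characters `λ_f`.

This file PROVES the lemma in that split setting, for Mathlib's `CuspForm 𝒮ℒ k` and the tree's Hecke ring
`𝕋_ℤ = levelOneHeckeRing k` (Diamond–Shurman Def. 6.5.2) with its `ℤ`-basis `T(1), …, T(d)`, `d = dim S_k`
(`levelOneHeckeRing.basisT`, Edixhoven Thm. 2.5.11) and eigenvalue characters `λ_f = eigenvalueHom`
(Diamond–Shurman §6.5): let `R` be a commutative ring with an injective ring map `e : R → ℂ` whose image contains the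
coefficients `a_n(f)`, `n ≥ 1`, of every normalized eigenform `f ∈ S_k` (DG: `R = 𝓞_K`), `P` a prime ideal of `R`
(DG: `P ∣ N_k`), and `θ : 𝕋_ℤ → R/P` ANY ring homomorphism (DG: `T(n) ↦ σ_{k−1}(n)`; Deligne–Serre: the `χ` of a
mod-`𝔪` eigenvector). Then there is a normalized eigenform `f` whose eigenvalue character, which takes values in
`e(R) ≅ R`, reduces to `θ` modulo `P`: `λ_f(T) mod P = θ(T)` for all `T ∈ 𝕋_ℤ`, in particular
`a_n(f) ≡ θ(T(n)) (mod P)`.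

Proof (the printed one, in the split case where it becomes prime avoidance): let `B ⊆ R^ι` (`ι` = the normalized
eigenforms) be the `R`-span of the eigenvalue vectors `Λ(T) = (λ_f(T))_f`, `T ∈ 𝕋_ℤ` — an `R`-subalgebra, free on
`Λ(T(1)), …, Λ(T(d))` (their `ℂ`-independence is that of `T(1), …, T(d)`, the tree's `linearIndependent_heckeTCuspₗ`,
transported by `𝕋_ℂ ≅ ℂ^ι`, the tree's `levelOneHeckeAlgebra.eigenvalues_injective`); `θ` extends `R`-linearly to an
`R`-algebra map `χ : B → R/P`; the kernels `𝔭_f` of the coordinate projections `π_f : B → R` have product `0 ⊆ Ker χ`,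
which is prime, so some `𝔭_f ⊆ Ker χ` («il existe un idéal premier 𝔭 … contenu dans Ker(χ)»), and `χ` factors through
`B/𝔭_f = R`, i.e. `χ = (π_f mod P)` («c'est le noyau d'un homomorphisme χ' : ℋ → 𝒪 dont la réduction mod 𝔪 est χ»).

## Contents (theorems + plumbing definitions with bodies; no named fact)

* §1 ★`Subalgebra.exists_algHom_eq_algebraMap_eval` — the diagonal case of Lemme 6.11 in pure algebra: for an
  `R`-subalgebra `B ⊆ R^ι` (`ι` finite) and an `R`-algebra map `χ : B → F` to a domain, `χ = (algebraMap R F) ∘ π_j`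
  for some coordinate `j`.
* §2 `liftOfRangeLE` (a ring map `A → ℂ` with image in `e(R)`, `e` injective, lifts to `A → R`), `eigenvalueHom_mem`
  (`λ_f(𝕋_ℤ) ⊆` any subring containing the `a_n(f)`), `eigenvalueHomLift` (`λ_f` with values in `R`).
* §3 `eigenvalueVectors` (`Λ : 𝕋_ℤ → R^ι`), `linearIndependent_eigenvalueVectors_basisT`, `eigenvalueAlgebra` (`B`)
  with its basis `eigenvalueAlgebraBasis`, `eigenvalueAlgebraCharacter` (`χ`), and the main theorem
  ★**`exists_eigenform_eigenvalueHom_congr`** (with the coefficient form ★`exists_eigenform_coeff_congr`: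
  `a_n(f) ≡ θ(T(n)) (mod P)` for all `n ≥ 1`).

## References

* [DeligneSerreASENS1974] P. Deligne, J.-P. Serre, Ann. Sci. ÉNS (4) 7 (1974), Lemme 6.11 and proof (p. 522).
* [DatskovskyGuerzhoy1996] B. Datskovsky, P. Guerzhoy, Proc. AMS 124 (1996), Thm. 2 and its proof, Lemma 2.1
  (p. 2285–2286).
* [DiamondShurman2005] F. Diamond, J. Shurman, GTM 228, Def. 6.5.2, §6.5 (`λ_f`, (6.12)), Thm. 6.5.4.
-/

noncomputable section

open scoped MatrixGroups ModularForm
open UpperHalfPlane hiding I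

/-! ## §1 The diagonal case of Deligne–Serre's Lemme 6.11 (pure algebra) -/

namespace Subalgebra

/-- ★ **Deligne–Serre's Lemme 6.11, split (diagonal) case.** Let `R` be a commutative ring, `ι` a finite index set,
`B ⊆ R^ι` an `R`-subalgebra and `χ : B → F` an `R`-algebra homomorphism to a domain `F` (an `R`-algebra; typically
`F = R/P`). Then `χ` is the reduction of a coordinate projection: there is `j ∈ ι` with `χ(b) = b_j · 1_F` for all
`b ∈ B`. (The kernels `𝔭_i` of the projections `B → R` have product `0`, contained in the prime `Ker χ`, so some
`𝔭_j ⊆ Ker χ` — «il existe un idéal premier `𝔭` de `ℋ` contenu dans l'idéal maximal `Ker(χ)` … c'est le noyau d'un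
homomorphisme `χ' : ℋ → 𝒪` dont la réduction mod `𝔪` est `χ`»; and `b − b_j·1 ∈ 𝔭_j`.)
[cite: DeligneSerreASENS1974, Lemme 6.11 (proof)] -/
theorem exists_algHom_eq_algebraMap_eval {R : Type*} [CommRing R] {ι : Type*} [Finite ι]
    (B : Subalgebra R (ι → R)) {F : Type*} [CommRing F] [IsDomain F] [Algebra R F] (χ : B →ₐ[R] F) :
    ∃ j : ι, ∀ b : B, χ b = algebraMap R F ((b : ι → R) j) := by
  classical
  haveI := Fintype.ofFinite ι
  -- the kernels of the coordinate projections
  let π : ι → (B →+* R) := fun i => (Pi.evalRingHom (fun _ : ι => R) i).comp B.val.toRingHom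
  have hπ : ∀ i (b : B), π i b = (b : ι → R) i := fun i b => rfl
  -- their product is `0`
  have hprod : (Finset.univ.prod fun i => RingHom.ker (π i)) ≤ RingHom.ker χ.toRingHom := by
    refine le_trans Ideal.prod_le_inf (le_trans ?_ bot_le)
    intro b hb
    rw [Ideal.mem_bot]
    refine Subtype.ext (funext fun i => ?_)
    have hi : b ∈ RingHom.ker (π i) := (Submodule.mem_finsetInf.mp hb) i (Finset.mem_univ i)
    rw [RingHom.mem_ker, hπ] at hi
    rw [hi]
    rfl
  -- `Ker χ` is prime, so it contains some `𝔭_j`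
  haveI : (RingHom.ker χ.toRingHom).IsPrime := RingHom.ker_isPrime _
  obtain ⟨j, -, hj⟩ := (Ideal.IsPrime.prod_le inferInstance).mp hprod
  refine ⟨j, fun b => ?_⟩
  -- `b − b_j · 1 ∈ 𝔭_j ⊆ Ker χ`
  have hmem : b - algebraMap R B ((b : ι → R) j) ∈ RingHom.ker (π j) := by
    rw [RingHom.mem_ker, map_sub, hπ, hπ, Subalgebra.coe_algebraMap, Pi.algebraMap_apply,
      Algebra.algebraMap_self_apply, sub_self]
  have hker := hj hmem
  rw [RingHom.mem_ker, AlgHom.toRingHom_eq_coe, AlgHom.coe_toRingHom, map_sub, AlgHom.commutes, sub_eq_zero] at hker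
  exact hker

end Subalgebra

namespace Literature.NumberTheory.ModularForms

variable {k : ℤ}

/-! ## §2 Eigenvalue characters with values in a ring `R ↪ ℂ` -/

section Lift

variable {R : Type*} [CommRing R]

/-- Lift a ring homomorphism `φ : A → ℂ` along an injective `e : R → ℂ` whose image contains `φ(A)`.
[cite: DatskovskyGuerzhoy1996, Thm. 2 ("Let `K` be an algebraic number field containing the Fourier coefficients")] -/
def liftOfRangeLE {A : Type*} [Ring A] (φ : A →+* ℂ) (e : R →+* ℂ) (he : Function.Injective e)
    (h : ∀ a, φ a ∈ e.range) : A →+* R where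
  toFun a := (h a).choose
  map_one' := he (by rw [(h 1).choose_spec, map_one, map_one])
  map_mul' a b := he (by rw [(h (a * b)).choose_spec, map_mul, map_mul, (h a).choose_spec, (h b).choose_spec])
  map_zero' := he (by rw [(h 0).choose_spec, map_zero, map_zero])
  map_add' a b := he (by rw [(h (a + b)).choose_spec, map_add, map_add, (h a).choose_spec, (h b).choose_spec])

/-- Defining property: `e (lift φ a) = φ a`. [cite: DatskovskyGuerzhoy1996, Thm. 2] -/
theorem apply_liftOfRangeLE {A : Type*} [Ring A] (φ : A →+* ℂ) (e : R →+* ℂ) (he : Function.Injective e)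
    (h : ∀ a, φ a ∈ e.range) (a : A) : e (liftOfRangeLE φ e he h a) = φ a :=
  (h a).choose_spec

/-- `λ_f(𝕋_ℤ)` lies in every subring of `ℂ` containing the coefficients `a_n(f)`, `n ≥ 1` (`𝕋_ℤ = ℤ[T(n)]` and
`λ_f(T(n)) = a_n(f)`; Diamond–Shurman: "the image is `ℤ[{a_n(f)}]`"). [cite: DiamondShurman2005, §6.5 (6.12)] -/
theorem eigenvalueHom_mem {f : CuspForm 𝒮ℒ k} (hf : IsNormalizedCuspEigenform f) (S : Subring ℂ)
    (hS : ∀ n, 0 < n → (qExpansion 1 ⇑f).coeff n ∈ S) (T : levelOneHeckeRing k) : eigenvalueHom hf T ∈ S := by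
  obtain ⟨T, hT⟩ := T
  induction hT using Algebra.adjoin_induction with
  | mem T hT =>
    obtain ⟨n, rfl⟩ := hT
    rw [eigenvalueHom_heckeTCuspₗ hf n.pos]
    exact hS n n.pos
  | algebraMap m =>
    have : (⟨algebraMap ℤ (Module.End ℂ (CuspForm 𝒮ℒ k)) m, Subalgebra.algebraMap_mem _ m⟩ : levelOneHeckeRing k) =
        (m : levelOneHeckeRing k) := Subtype.ext (by
      change algebraMap ℤ (Module.End ℂ (CuspForm 𝒮ℒ k)) m = ((m : levelOneHeckeRing k) : Module.End ℂ (CuspForm 𝒮ℒ k))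
      rw [SubringClass.coe_intCast, eq_intCast])
    rw [this, map_intCast]
    exact intCast_mem S m
  | add T U hT hU ihT ihU =>
    have : (⟨T + U, add_mem hT hU⟩ : levelOneHeckeRing k) = ⟨T, hT⟩ + ⟨U, hU⟩ := rfl
    rw [this, map_add]
    exact add_mem ihT ihU
  | mul T U hT hU ihT ihU =>
    have : (⟨T * U, mul_mem hT hU⟩ : levelOneHeckeRing k) = ⟨T, hT⟩ * ⟨U, hU⟩ := rfl
    rw [this, map_mul]
    exact mul_mem ihT ihU

/-- **The eigenvalue character with values in `R`**: for an injective `e : R → ℂ` whose image contains the `a_n(f)`,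
`n ≥ 1`, the character `λ_f : 𝕋_ℤ → ℂ` lifts uniquely to `λ_f^R : 𝕋_ℤ → R` (`e ∘ λ_f^R = λ_f`). (DG: "The coefficients
of primitive forms are algebraic integers in some algebraic number field `K`", `R = 𝓞_K`.)
[cite: DatskovskyGuerzhoy1996, Thm. 2] [cite: DiamondShurman2005, §6.5 (`λ_f`)] -/
def eigenvalueHomLift {f : CuspForm 𝒮ℒ k} (hf : IsNormalizedCuspEigenform f) (e : R →+* ℂ)
    (he : Function.Injective e) (hR : ∀ n, 0 < n → (qExpansion 1 ⇑f).coeff n ∈ e.range) : levelOneHeckeRing k →+* R :=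
  liftOfRangeLE (eigenvalueHom hf) e he (eigenvalueHom_mem hf e.range hR)

/-- `e (λ_f^R T) = λ_f(T)`. [cite: DiamondShurman2005, §6.5 (`λ_f`)] -/
theorem apply_eigenvalueHomLift {f : CuspForm 𝒮ℒ k} (hf : IsNormalizedCuspEigenform f) (e : R →+* ℂ)
    (he : Function.Injective e) (hR : ∀ n, 0 < n → (qExpansion 1 ⇑f).coeff n ∈ e.range) (T : levelOneHeckeRing k) :
    e (eigenvalueHomLift hf e he hR T) = eigenvalueHom hf T :=
  apply_liftOfRangeLE _ _ _ _ T

/-- `e (λ_f^R (T(n))) = a_n(f)`. [cite: DiamondShurman2005, §6.5 ("`λ_f(T_n) = a_n(f)`")] -/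
theorem apply_eigenvalueHomLift_heckeTCuspₗ {f : CuspForm 𝒮ℒ k} (hf : IsNormalizedCuspEigenform f) (e : R →+* ℂ)
    (he : Function.Injective e) (hR : ∀ n, 0 < n → (qExpansion 1 ⇑f).coeff n ∈ e.range) {n : ℕ} (hn : 0 < n) :
    e (eigenvalueHomLift hf e he hR ⟨heckeTCuspₗ hn, heckeTCuspₗ_mem_levelOneHeckeRing hn⟩) =
      (qExpansion 1 ⇑f).coeff n := by
  rw [apply_eigenvalueHomLift, eigenvalueHom_heckeTCuspₗ]

end Lift

/-! ## §3 The algebra `B` of eigenvalue vectors and the lifting theorem -/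

section Lifting

variable {R : Type*} [CommRing R] (e : R →+* ℂ) (he : Function.Injective e)
  (hR : ∀ f : CuspForm 𝒮ℒ k, IsNormalizedCuspEigenform f → ∀ n, 0 < n → (qExpansion 1 ⇑f).coeff n ∈ e.range)

/-- The index set of normalized eigenforms of `S_k(SL₂(ℤ))` is finite. [cite: DiamondShurman2005, §6.5 (the finite
basis of normalized eigenforms)] -/
theorem finite_subtype_isNormalizedCuspEigenform (k : ℤ) :
    Finite {f : CuspForm 𝒮ℒ k // IsNormalizedCuspEigenform f} :=
  (finite_setOf_isNormalizedCuspEigenform k).to_subtype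

/-- **The eigenvalue vectors `Λ : 𝕋_ℤ → R^ι`, `Λ(T) = (λ_f(T))_f`** over the normalized eigenforms `f` (the
diagonalisation «`K ⊗ ℋ` est un produit d'anneaux … de corps résiduel `K`»). [cite: DeligneSerreASENS1974, Lemme 6.11
(proof)] [cite: DatskovskyGuerzhoy1996, Thm. 2 (the `φ_1, …, φ_t` and `K`)] -/
def eigenvalueVectors : levelOneHeckeRing k →+* ({f : CuspForm 𝒮ℒ k // IsNormalizedCuspEigenform f} → R) :=
  RingHom.pi fun f => eigenvalueHomLift f.2 e he (hR f.1 f.2)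

/-- Unfolding lemma: `Λ(T)_f = λ_f^R(T)`. [cite: DatskovskyGuerzhoy1996, Thm. 2] -/
theorem eigenvalueVectors_apply (T : levelOneHeckeRing k) (f : {f : CuspForm 𝒮ℒ k // IsNormalizedCuspEigenform f}) :
    eigenvalueVectors e he hR T f = eigenvalueHomLift f.2 e he (hR f.1 f.2) T := rfl

/-- ★ **`Λ(T(1)), …, Λ(T(d))` are linearly independent over `R`** (`d = dim S_k`): a relation `Σ a_i Λ(T(i)) = 0`
gives, after `e`, an element `Σ e(a_i) T(i)` of `𝕋_ℂ` killing every normalized eigenform, hence `0`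
(`levelOneHeckeAlgebra.eigenvalues_injective`), and `T(1), …, T(d)` are `ℂ`-independent
(`linearIndependent_heckeTCuspₗ`). [cite: DiamondShurman2005, §6.5 (the basis of eigenforms)]
[cite: DeligneSerreASENS1974, Lemme 6.11 (proof: «ℋ est libre sur 𝒪»)] -/
theorem linearIndependent_eigenvalueVectors_basisT :
    LinearIndependent R fun i : Fin (Module.finrank ℂ (CuspForm 𝒮ℒ k)) =>
      eigenvalueVectors e he hR (levelOneHeckeRing.basisT k i) := by
  rw [Fintype.linearIndependent_iff]
  intro a ha i
  -- the complex combination `D = Σ e(a_i) T(i+1)` lies in `𝕋_ℂ` and has all eigenvalues `0`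
  set D : levelOneHeckeAlgebra k :=
    ∑ j, e (a j) • ⟨heckeTCuspₗ (Nat.succ_pos j), heckeTCuspₗ_mem_levelOneHeckeAlgebra (Nat.succ_pos j)⟩ with hD
  have hDeig : levelOneHeckeAlgebra.eigenvalues k D = 0 := by
    funext f
    have haf := congrFun ha f
    rw [Finset.sum_apply, Pi.zero_apply] at haf
    have haf' := congrArg e haf
    rw [map_sum, map_zero] at haf'
    rw [Pi.zero_apply, hD, map_sum, Finset.sum_apply]
    rw [← haf']
    refine Finset.sum_congr rfl fun j _ => ?_
    rw [Pi.smul_apply, smul_eq_mul, map_mul, map_smul, Pi.smul_apply, smul_eq_mul, eigenvalueVectors_apply]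
    congr 1
    rw [apply_eigenvalueHomLift, eigenvalueHom_apply, levelOneHeckeAlgebra.eigenvalues_apply,
      levelOneHeckeRing.coe_basisT_apply]
  have hD0 : D = 0 := levelOneHeckeAlgebra.eigenvalues_injective k (by rw [hDeig, map_zero])
  have hD0' : ∑ j, e (a j) • heckeTCuspₗ (k := k) (Nat.succ_pos j) = 0 := by
    have := congrArg (fun T : levelOneHeckeAlgebra k => (T : Module.End ℂ (CuspForm 𝒮ℒ k))) hD0
    simpa only [hD, Subalgebra.coe_zero, AddSubmonoidClass.coe_finsetSum, Subalgebra.coe_smul] using this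
  have hli := Fintype.linearIndependent_iff.mp (linearIndependent_heckeTCuspₗ k) (fun j => e (a j)) hD0' i
  exact he (by rw [hli, map_zero])

/-- **The algebra `B` of eigenvalue vectors**: the `R`-subalgebra of `R^ι` generated by (equivalently, by
`span_eigenvalueVectors_basisT`, `R`-spanned by) the `Λ(T)`, `T ∈ 𝕋_ℤ` — Deligne–Serre's `ℋ` after extension of
scalars to `R`, in its diagonal realisation. [cite: DeligneSerreASENS1974, Lemme 6.11 (proof, «extension finie des
scalaires»)] -/
def eigenvalueAlgebra : Subalgebra R ({f : CuspForm 𝒮ℒ k // IsNormalizedCuspEigenform f} → R) :=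
  Algebra.adjoin R (Set.range (eigenvalueVectors e he hR))

/-- `Λ(T) ∈ B`. [cite: DeligneSerreASENS1974, Lemme 6.11 (proof)] -/
theorem eigenvalueVectors_mem (T : levelOneHeckeRing k) : eigenvalueVectors e he hR T ∈ eigenvalueAlgebra e he hR :=
  Algebra.subset_adjoin ⟨T, rfl⟩

/-- `Λ` with values in `B`. [cite: DeligneSerreASENS1974, Lemme 6.11 (proof)] -/
def eigenvalueVectorsB : levelOneHeckeRing k →+* eigenvalueAlgebra e he hR :=
  (eigenvalueVectors e he hR).codRestrict (eigenvalueAlgebra e he hR) (eigenvalueVectors_mem e he hR)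

/-- Unfolding lemma. [cite: DeligneSerreASENS1974, Lemme 6.11 (proof)] -/
theorem coe_eigenvalueVectorsB (T : levelOneHeckeRing k) :
    ((eigenvalueVectorsB e he hR T : eigenvalueAlgebra e he hR) :
      {f : CuspForm 𝒮ℒ k // IsNormalizedCuspEigenform f} → R) = eigenvalueVectors e he hR T :=
  rfl

/-- **`B` is the `R`-span of `Λ(T(1)), …, Λ(T(d))`** (`𝕋_ℤ = ℤT(1) ⊕ ⋯ ⊕ ℤT(d)` and the span is multiplicatively
closed since `Λ` is a ring homomorphism). [cite: DeligneSerreASENS1974, Lemme 6.11 (proof)] [cite: DiamondShurman2005,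
Def. 6.5.2] -/
theorem eigenvalueAlgebra_toSubmodule_eq_span :
    Subalgebra.toSubmodule (eigenvalueAlgebra e he hR) =
      Submodule.span R (Set.range fun i : Fin (Module.finrank ℂ (CuspForm 𝒮ℒ k)) =>
        eigenvalueVectors e he hR (levelOneHeckeRing.basisT k i)) := by
  set S := Submodule.span R (Set.range fun i : Fin (Module.finrank ℂ (CuspForm 𝒮ℒ k)) =>
    eigenvalueVectors e he hR (levelOneHeckeRing.basisT k i)) with hS
  -- every `Λ(T)` lies in `S`
  have hΛ : ∀ T : levelOneHeckeRing k, eigenvalueVectors e he hR T ∈ S := by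
    intro T
    have hT : T ∈ Submodule.span ℤ (Set.range (levelOneHeckeRing.basisT k)) := by
      rw [(levelOneHeckeRing.basisT k).span_eq]; exact Submodule.mem_top
    induction hT using Submodule.span_induction with
    | mem x hx =>
      obtain ⟨i, rfl⟩ := hx
      exact Submodule.subset_span ⟨i, rfl⟩
    | zero => rw [map_zero]; exact S.zero_mem
    | add x y _ _ hx hy => rw [map_add]; exact S.add_mem hx hy
    | smul m x _ hx => rw [map_zsmul]; exact zsmul_mem hx m
  apply le_antisymm
  · -- `adjoin ≤ S`: `S` is a subalgebra
    have h1 : (1 : {f : CuspForm 𝒮ℒ k // IsNormalizedCuspEigenform f} → R) ∈ S := by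
      rw [← map_one (eigenvalueVectors e he hR)]
      exact hΛ 1
    have hmul : ∀ x y, x ∈ S → y ∈ S → x * y ∈ S := by
      intro x y hx hy
      have hsub : S * S ≤ S := by
        rw [hS, Submodule.span_mul_span, Submodule.span_le]
        rintro _ ⟨_, ⟨i, rfl⟩, _, ⟨j, rfl⟩, rfl⟩
        show eigenvalueVectors e he hR (levelOneHeckeRing.basisT k i) *
          eigenvalueVectors e he hR (levelOneHeckeRing.basisT k j) ∈ S
        rw [← map_mul]
        exact hΛ _
      exact hsub (Submodule.mul_mem_mul hx hy)
    change eigenvalueAlgebra e he hR ≤ S.toSubalgebra h1 hmul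
    refine Algebra.adjoin_le ?_
    rintro _ ⟨T, rfl⟩
    exact hΛ T
  · rw [Submodule.span_le]
    rintro _ ⟨i, rfl⟩
    exact eigenvalueVectors_mem e he hR _

/-- ★ **`B` is free over `R` with basis `Λ(T(1)), …, Λ(T(d))`** («Puisque `ℋ` est libre sur `𝒪`»).
[cite: DeligneSerreASENS1974, Lemme 6.11 (proof)] -/
def eigenvalueAlgebraBasis :
    Module.Basis (Fin (Module.finrank ℂ (CuspForm 𝒮ℒ k))) R (eigenvalueAlgebra e he hR) :=
  Module.Basis.mk (v := fun i => eigenvalueVectorsB e he hR (levelOneHeckeRing.basisT k i))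
    ((linearIndependent_eigenvalueVectors_basisT e he hR).of_comp (eigenvalueAlgebra e he hR).val.toLinearMap)
    (by
      rintro ⟨b, hb⟩ -
      have hb' : b ∈ Subalgebra.toSubmodule (eigenvalueAlgebra e he hR) := hb
      rw [eigenvalueAlgebra_toSubmodule_eq_span] at hb'
      have hinj : Function.Injective ((eigenvalueAlgebra e he hR).val.toLinearMap) := Subtype.val_injective
      rw [← Submodule.apply_mem_span_image_iff_mem_span hinj, ← Set.range_comp]
      exact hb')

/-- Unfolding lemma: the `i`-th basis vector is `Λ(T(i+1))`. [cite: DeligneSerreASENS1974, Lemme 6.11 (proof)] -/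
theorem eigenvalueAlgebraBasis_apply (i : Fin (Module.finrank ℂ (CuspForm 𝒮ℒ k))) :
    eigenvalueAlgebraBasis e he hR i = eigenvalueVectorsB e he hR (levelOneHeckeRing.basisT k i) := by
  rw [eigenvalueAlgebraBasis, Module.Basis.coe_mk]

variable {F : Type*} [CommRing F] [Algebra R F] (θ : levelOneHeckeRing k →+* F)

/-- The `R`-linear extension `χ₀ : B → F` of `θ` (`χ₀(Λ(T(i))) = θ(T(i))` on the basis).
[cite: DeligneSerreASENS1974, Lemme 6.11 (proof, the homomorphism `χ`)] -/
def eigenvalueAlgebraCharacterₗ : eigenvalueAlgebra e he hR →ₗ[R] F :=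
  (eigenvalueAlgebraBasis e he hR).constr R fun i => θ (levelOneHeckeRing.basisT k i)

/-- ★ **`χ₀(Λ(T)) = θ(T)` for every `T ∈ 𝕋_ℤ`** (two additive maps on `𝕋_ℤ` agreeing on the `ℤ`-basis `T(1..d)`).
[cite: DeligneSerreASENS1974, Lemme 6.11 (proof)] -/
theorem eigenvalueAlgebraCharacterₗ_eigenvalueVectorsB (T : levelOneHeckeRing k) :
    eigenvalueAlgebraCharacterₗ e he hR θ (eigenvalueVectorsB e he hR T) = θ T := by
  -- both sides are `ℤ`-linear in `T`
  set φ₁ : levelOneHeckeRing k →ₗ[ℤ] F :=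
    ((eigenvalueAlgebraCharacterₗ e he hR θ).toAddMonoidHom.comp
      (eigenvalueVectorsB e he hR).toAddMonoidHom).toIntLinearMap with hφ₁
  set φ₂ : levelOneHeckeRing k →ₗ[ℤ] F := θ.toAddMonoidHom.toIntLinearMap with hφ₂
  have h : φ₁ = φ₂ := by
    refine (levelOneHeckeRing.basisT k).ext fun i => ?_
    change eigenvalueAlgebraCharacterₗ e he hR θ (eigenvalueVectorsB e he hR (levelOneHeckeRing.basisT k i)) =
      θ (levelOneHeckeRing.basisT k i)
    rw [← eigenvalueAlgebraBasis_apply, eigenvalueAlgebraCharacterₗ, Module.Basis.constr_basis]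
  exact congrArg (fun φ : levelOneHeckeRing k →ₗ[ℤ] F => φ T) h

/-- ★ **The `R`-algebra homomorphism `χ : B → F` extending `θ`** (`χ₀` is multiplicative: check on the basis, where
`Λ(T(i))Λ(T(j)) = Λ(T(i)T(j))` and `θ` is multiplicative; `χ₀(1) = χ₀(Λ(1)) = θ(1) = 1`).
[cite: DeligneSerreASENS1974, Lemme 6.11 (proof, `χ : ℋ → k`)] -/
def eigenvalueAlgebraCharacter : eigenvalueAlgebra e he hR →ₐ[R] F :=
  AlgHom.ofLinearMap (eigenvalueAlgebraCharacterₗ e he hR θ)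
    (by rw [← map_one (eigenvalueVectorsB e he hR), eigenvalueAlgebraCharacterₗ_eigenvalueVectorsB, map_one])
    (by
      -- bilinear identity, checked on the basis
      set χ₀ := eigenvalueAlgebraCharacterₗ e he hR θ
      set b := eigenvalueAlgebraBasis e he hR
      have key : ∀ i j, χ₀ (b i * b j) = χ₀ (b i) * χ₀ (b j) := by
        intro i j
        rw [eigenvalueAlgebraBasis_apply, eigenvalueAlgebraBasis_apply, ← map_mul,
          eigenvalueAlgebraCharacterₗ_eigenvalueVectorsB, eigenvalueAlgebraCharacterₗ_eigenvalueVectorsB,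
          eigenvalueAlgebraCharacterₗ_eigenvalueVectorsB, map_mul]
      intro x y
      have hL : (LinearMap.mul R (eigenvalueAlgebra e he hR)).compr₂ χ₀ =
          (LinearMap.mul R F).compl₁₂ χ₀ χ₀ := by
        refine b.ext fun i => b.ext fun j => ?_
        simp only [LinearMap.compr₂_apply, LinearMap.compl₁₂_apply, LinearMap.mul_apply', key]
      have := congrArg (fun L : eigenvalueAlgebra e he hR →ₗ[R] eigenvalueAlgebra e he hR →ₗ[R] F => L x y) hL
      simpa only [LinearMap.compr₂_apply, LinearMap.compl₁₂_apply, LinearMap.mul_apply'] using this)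

/-- `χ(Λ(T)) = θ(T)`. [cite: DeligneSerreASENS1974, Lemme 6.11 (proof)] -/
theorem eigenvalueAlgebraCharacter_eigenvalueVectorsB (T : levelOneHeckeRing k) :
    eigenvalueAlgebraCharacter e he hR θ (eigenvalueVectorsB e he hR T) = θ T :=
  eigenvalueAlgebraCharacterₗ_eigenvalueVectorsB e he hR θ T

/-- ★ **Deligne–Serre lifting for `S_k(SL₂(ℤ))` (split case).** Let `e : R ↪ ℂ` be an injective ring map whose
image contains the coefficients `a_n(f)`, `n ≥ 1`, of all normalized eigenforms `f ∈ S_k(SL₂(ℤ))`, `P` a prime ideal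
of `R`, and `θ : 𝕋_ℤ → R/P` a ring homomorphism. Then there is a normalized eigenform `f` whose eigenvalue character
reduces to `θ`: `λ_f^R(T) mod P = θ(T)` for every `T ∈ 𝕋_ℤ` («il existe … `χ' : ℋ → 𝒪` dont la réduction mod `𝔪`
est `χ`»; here `χ' = λ_f`). [cite: DeligneSerreASENS1974, Lemme 6.11] [cite: DatskovskyGuerzhoy1996, Thm. 2 (proof:
"follows easily from Theorem 1 and Lemma 6.11 of [2]")] -/
theorem exists_eigenform_eigenvalueHom_congr (P : Ideal R) [P.IsPrime]
    (θ : levelOneHeckeRing k →+* R ⧸ P) :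
    ∃ f : {f : CuspForm 𝒮ℒ k // IsNormalizedCuspEigenform f}, ∀ T : levelOneHeckeRing k,
      Ideal.Quotient.mk P (eigenvalueHomLift f.2 e he (hR f.1 f.2) T) = θ T := by
  haveI := finite_subtype_isNormalizedCuspEigenform k
  obtain ⟨f, hf⟩ := (eigenvalueAlgebra e he hR).exists_algHom_eq_algebraMap_eval
    (eigenvalueAlgebraCharacter e he hR θ)
  refine ⟨f, fun T => ?_⟩
  rw [← eigenvalueAlgebraCharacter_eigenvalueVectorsB e he hR θ T, hf, Ideal.Quotient.algebraMap_eq,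
    coe_eigenvalueVectorsB, eigenvalueVectors_apply]

include he hR in
/-- ★ **Coefficient form.** Under the same hypotheses there is a normalized eigenform `f` and, for every `n ≥ 1`, an
element `x_n ∈ R` with `e(x_n) = a_n(f)` and `x_n mod P = θ(T(n))`: **`a_n(f) ≡ θ(T(n)) (mod P)`** — Deligne–Serre's
«`a'_T ≡ a_T (mod 𝔪')`», Datskovsky–Guerzhoy's «`φ_i ≡ G_k mod P`» once `θ(T(n)) = σ_{k−1}(n)`.
[cite: DeligneSerreASENS1974, Lemme 6.11] [cite: DatskovskyGuerzhoy1996, Thm. 2] -/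
theorem exists_eigenform_coeff_congr (P : Ideal R) [P.IsPrime] (θ : levelOneHeckeRing k →+* R ⧸ P) :
    ∃ f : CuspForm 𝒮ℒ k, IsNormalizedCuspEigenform f ∧ ∀ (n : ℕ) (hn : 0 < n), ∃ x : R,
      e x = (qExpansion 1 ⇑f).coeff n ∧
        Ideal.Quotient.mk P x = θ ⟨heckeTCuspₗ hn, heckeTCuspₗ_mem_levelOneHeckeRing hn⟩ := by
  obtain ⟨f, hf⟩ := exists_eigenform_eigenvalueHom_congr e he hR P θ
  exact ⟨f.1, f.2, fun n hn => ⟨_, apply_eigenvalueHomLift_heckeTCuspₗ f.2 e he (hR f.1 f.2) hn, hf _⟩⟩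

end Lifting

end Literature.NumberTheory.ModularForms
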